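import Summits.NavierStokesRegularity.NavierStokesRegularity.Theorems.HardyPointSinkHardyEnergyBoundLedgerSlice
import HarnessLib

/-!
# Route HardyPointSink — `HardyEnergyBound`, ledger stub: slice integrals and the pressure swap

Helper file 3/5 for the glue stub `stub_hardyLedger_of` (item stmt-NavierStokesRegularity-7979, line
`birth`). For one time slice (`w` continuous in `L³`, `Π = Π[w]` its Riesz pressure, `φ` the plateau
cut-off, sink `x₀ ∈ B(xs, R/4)`):

* integrability of the integrands `A`, `B_q`, `C_q`, `flux_q`, `Dφ(w)/r`, `φ⟨w, x−x₀⟩/r³`;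
* the uniform bounds `|∫A|, |∫B_Π|, |∫_{B_R}(φ−1)flux_Π| ≤ α + β ∫|w|³` (Hölder–Stein for `|Π||w|`);
* **the pressure swap**: if `q = Π + c` a.e. for a continuous `q` and `∫Dφ(w)/r = ∫φ⟨w,x−x₀⟩/r³`
  (solenoidal flux identity), then `∫(A + B_q − C_q) = ∫A + ∫B_Π − 2∫_{B_R}(φ−1)flux_Π − 2∫_{B_R}flux_Π`.
-/

noncomputable section

open MeasureTheory Set Filter Topology Metric Function
open scoped ENNReal NNReal InnerProductSpace Laplacian

set_option linter.dupNamespace false -- nested layout Summit.<S>.<Sub>, Sub = S (D-0017)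

namespace Summit.NavierStokesRegularity.NavierStokesRegularity.Theorems

open Literature.Analysis.FluidPDE Literature.Analysis.PDE


section Slice

variable {xs x₀ : (EuclideanSpace ℝ (Fin 3))} {R : ℝ} (hR : 0 < R) (hx₀ : x₀ ∈ ball xs (R / 4))
variable {L₁ L₂ : ℝ} (hL₁0 : 0 ≤ L₁) (hL₂0 : 0 ≤ L₂)
  (hL₁ : ∀ x, ‖fderiv ℝ (hardyEnergyBound_ledger_cutoff xs hR) x‖ ≤ L₁)
  (hL₂ : ∀ x, |(Δ (hardyEnergyBound_ledger_cutoff xs hR)) x| ≤ L₂)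
variable {w : (EuclideanSpace ℝ (Fin 3)) → (EuclideanSpace ℝ (Fin 3))} (hw : Continuous w)

include hw

/-! ### Integrability of the slice integrands -/

/-- Powers of `|w|` are integrable on compact sets. -/
theorem hardyEnergyBound_ledger_integrableOn_norm_pow {K : Set (EuclideanSpace ℝ (Fin 3))} (hK : IsCompact K) (a : ℝ) (k : ℕ) :
    IntegrableOn (fun x => a * ‖w x‖ ^ k) K :=
  (continuous_const.mul (hw.norm.pow k)).continuousOn.integrableOn_compact hK

include hx₀ hL₁0 hL₂0 hL₁ hL₂ in
/-- `A` is integrable. -/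
theorem hardyEnergyBound_ledger_integrable_ledgerA (ν : ℝ) :
    Integrable (hardyEnergyBound_ledgerA ν (hardyEnergyBound_ledger_cutoff xs hR) w x₀) :=
  hardyEnergyBound_ledger_integrable_of_supported measurableSet_closedBall
    (hardyEnergyBound_ledger_measurable_ledgerA hR ν hw).aestronglyMeasurable
    (hardyEnergyBound_ledger_integrableOn_norm_pow hw (isCompact_closedBall xs R) _ 2)
    (fun x _ => hardyEnergyBound_ledger_abs_ledgerA_le hR hx₀ hL₁0 hL₂0 hL₁ hL₂ ν w x)
    (fun _ hx => hardyEnergyBound_ledgerA_eq_zero hR ν w hx)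

include hx₀ hL₁0 hL₁ in
/-- `B_q` is integrable whenever `|q||w|` is integrable on `B̄(xs, R)`. -/
theorem hardyEnergyBound_ledger_integrable_ledgerB {q : (EuclideanSpace ℝ (Fin 3)) → ℝ} (hq : AEStronglyMeasurable q volume)
    (hqw : IntegrableOn (fun x => |q x| * ‖w x‖) (closedBall xs R)) :
    Integrable (hardyEnergyBound_ledgerB (hardyEnergyBound_ledger_cutoff xs hR) w q x₀) := by
  refine hardyEnergyBound_ledger_integrable_of_supported measurableSet_closedBall
    (hardyEnergyBound_ledger_aestronglyMeasurable_ledgerB hR hw hq)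
    (g := fun x => 4 * L₁ / R * ((‖w x‖ ^ 2 + 2 * |q x|) * ‖w x‖)) ?_
    (fun x _ => hardyEnergyBound_ledger_abs_ledgerB_le hR hx₀ hL₁0 hL₁ w q x)
    (fun x hx => hardyEnergyBound_ledgerB_eq_zero hR w q hx)
  have e : (fun x => 4 * L₁ / R * ((‖w x‖ ^ 2 + 2 * |q x|) * ‖w x‖)) =
      fun x => 4 * L₁ / R * ‖w x‖ ^ 3 + (8 * L₁ / R) * (|q x| * ‖w x‖) := by
    funext x; ring
  rw [e]
  exact (hardyEnergyBound_ledger_integrableOn_norm_pow hw (isCompact_closedBall xs R) _ 3).add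
    (hqw.const_mul _)

omit hw in
/-- For a continuous `q`, `|q||w|` is integrable on compact sets. -/
theorem hardyEnergyBound_ledger_integrableOn_abs_mul_norm {q : (EuclideanSpace ℝ (Fin 3)) → ℝ} (hq : Continuous q)
    (hw : Continuous w) {K : Set (EuclideanSpace ℝ (Fin 3))} (hK : IsCompact K) :
    IntegrableOn (fun x => |q x| * ‖w x‖) K :=
  ((continuous_abs.comp hq).mul hw.norm).continuousOn.integrableOn_compact hK

/-- The head-flux bound `(|w|²/2 + |q|)|w| r⁻²` is integrable on `B̄(xs, R)` for continuous `q`. -/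
theorem hardyEnergyBound_ledger_integrableOn_fluxBound {q : (EuclideanSpace ℝ (Fin 3)) → ℝ} (hq : Continuous q) :
    IntegrableOn (fun x => (‖w x‖ ^ 2 / 2 + |q x|) * ‖w x‖ * (‖x - x₀‖ ^ 2)⁻¹) (closedBall xs R) :=
  IntegrableOn.continuousOn_mul
    ((((hw.norm.pow 2).div_const 2).add (continuous_abs.comp hq)).mul hw.norm).continuousOn
    (hardyEnergyBound_ledger_integrableOn_inv_sq_closedBall x₀ xs R) (isCompact_closedBall xs R)

/-- `C_q` is integrable for continuous `q`. -/
theorem hardyEnergyBound_ledger_integrable_ledgerC {q : (EuclideanSpace ℝ (Fin 3)) → ℝ} (hq : Continuous q) :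
    Integrable (hardyEnergyBound_ledgerC (hardyEnergyBound_ledger_cutoff xs hR) w q x₀) :=
  hardyEnergyBound_ledger_integrable_of_supported measurableSet_closedBall
    (hardyEnergyBound_ledger_aestronglyMeasurable_ledgerC hR hw hq.aestronglyMeasurable)
    ((hardyEnergyBound_ledger_integrableOn_fluxBound hw hq).const_mul 2)
    (fun x _ => hardyEnergyBound_ledger_abs_ledgerC_le hR w q x)
    (fun _ hx => hardyEnergyBound_ledgerC_eq_zero hR w q fun h => hx (ball_subset_closedBall h))

omit hR in
/-- `flux_q` is integrable on `B(xs, R)` for continuous `q`. -/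
theorem hardyEnergyBound_ledger_integrableOn_ledgerFlux {q : (EuclideanSpace ℝ (Fin 3)) → ℝ} (hq : Continuous q) :
    IntegrableOn (hardyEnergyBound_ledgerFlux w q x₀) (ball xs R) :=
  (hardyEnergyBound_ledger_integrableOn_of_bound measurableSet_closedBall
    (hardyEnergyBound_ledger_aestronglyMeasurable_ledgerFlux hw hq.aestronglyMeasurable)
    (hardyEnergyBound_ledger_integrableOn_fluxBound hw hq)
    (fun x _ => hardyEnergyBound_ledger_abs_ledgerFlux_le w q x)).mono_set ball_subset_closedBall

omit hR in
/-- `⟨w, x − x₀⟩/r³` is integrable on `B(xs, R)`. -/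
theorem hardyEnergyBound_ledger_integrableOn_inner_div :
    IntegrableOn (fun x => inner ℝ (w x) (x - x₀) / ‖x - x₀‖ ^ 3) (ball xs R) := by
  refine (hardyEnergyBound_ledger_integrableOn_of_bound measurableSet_closedBall ?_
    (IntegrableOn.continuousOn_mul hw.norm.continuousOn
      (hardyEnergyBound_ledger_integrableOn_inv_sq_closedBall x₀ xs R) (isCompact_closedBall xs R))
    (fun x _ => hardyEnergyBound_ledger_abs_inner_div_cube_le (w x) x x₀)).mono_set
    ball_subset_closedBall
  exact ((hw.inner (continuous_id.sub continuous_const)).measurable.div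
    (((continuous_id.sub continuous_const).norm).pow 3).measurable).aestronglyMeasurable

include hx₀ hL₁0 hL₁ in
/-- `Dφ(w)/r` is integrable. -/
theorem hardyEnergyBound_ledger_integrable_fderiv_apply_div :
    Integrable fun x => fderiv ℝ (hardyEnergyBound_ledger_cutoff xs hR) x (w x) / ‖x - x₀‖ := by
  refine hardyEnergyBound_ledger_integrable_of_supported measurableSet_closedBall
    (hardyEnergyBound_ledger_measurable_fderiv_apply_div hR hw).aestronglyMeasurable
    (hardyEnergyBound_ledger_integrableOn_norm_pow hw (isCompact_closedBall xs R) (4 * L₁ / R) 1)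
    (fun x _ => by
      rw [pow_one]; exact hardyEnergyBound_ledger_abs_fderiv_apply_div_le hR hx₀ hL₁0 hL₁ (w x) x)
    (fun x hx => ?_)
  have h2 : fderiv ℝ (hardyEnergyBound_ledger_cutoff xs hR) x = 0 := by
    by_contra h
    exact hx (mem_closedBall.2 (hardyEnergyBound_ledger_annulus_of_fderiv_ne_zero xs hR h).2)
  rw [h2]
  simp

/-- `φ⟨w, x − x₀⟩/r³` is integrable. -/
theorem hardyEnergyBound_ledger_integrable_cutoff_mul_inner_div :
    Integrable fun x =>
      hardyEnergyBound_ledger_cutoff xs hR x * inner ℝ (w x) (x - x₀) / ‖x - x₀‖ ^ 3 := by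
  refine hardyEnergyBound_ledger_integrable_of_supported measurableSet_closedBall
    (hardyEnergyBound_ledger_measurable_cutoff_mul_inner_div hR hw).aestronglyMeasurable
    (IntegrableOn.continuousOn_mul hw.norm.continuousOn
      (hardyEnergyBound_ledger_integrableOn_inv_sq_closedBall x₀ xs R) (isCompact_closedBall xs R))
    (fun x _ => hardyEnergyBound_ledger_abs_cutoff_mul_inner_div_le hR (w x) x) (fun x hx => ?_)
  have h0 : hardyEnergyBound_ledger_cutoff xs hR x = 0 := by
    by_contra h
    exact hx (ball_subset_closedBall (hardyEnergyBound_ledger_mem_ball_of_cutoff_ne_zero xs hR h))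
  rw [h0, zero_mul, zero_div]

/-! ### Uniform bounds of the slice integrals against `∫ |w|³` -/

variable (hw3 : MemLp w 3 volume)
include hw3

omit hw in
/-- `∫_K |w|³ ≤ ∫ |w|³`. -/
theorem hardyEnergyBound_ledger_setIntegral_cube_le (K : Set (EuclideanSpace ℝ (Fin 3))) :
    ∫ x in K, ‖w x‖ ^ 3 ≤ ∫ x, ‖w x‖ ^ 3 :=
  setIntegral_le_integral (hw3.integrable_norm_pow three_ne_zero)
    (Eventually.of_forall fun x => by positivity)

/-- `∫_{B̄} |w|² ≤ |B̄| + ∫ |w|³`. -/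
theorem hardyEnergyBound_ledger_setIntegral_sq_le :
    ∫ x in closedBall xs R, ‖w x‖ ^ 2 ≤
      (volume : Measure (EuclideanSpace ℝ (Fin 3))).real (closedBall xs R) + ∫ x, ‖w x‖ ^ 3 := by
  have hK : IsCompact (closedBall xs R) := isCompact_closedBall xs R
  have h3 : IntegrableOn (fun x => ‖w x‖ ^ 3) (closedBall xs R) := by
    simpa using hardyEnergyBound_ledger_integrableOn_norm_pow hw hK 1 3
  have h2 : IntegrableOn (fun x => ‖w x‖ ^ 2) (closedBall xs R) := by
    simpa using hardyEnergyBound_ledger_integrableOn_norm_pow hw hK 1 2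
  have hc : IntegrableOn (fun _ => (1 : ℝ)) (closedBall xs R) :=
    integrableOn_const measure_closedBall_lt_top.ne
  have h13 : IntegrableOn (fun x => 1 + ‖w x‖ ^ 3) (closedBall xs R) := hc.add h3
  calc ∫ x in closedBall xs R, ‖w x‖ ^ 2 ≤ ∫ x in closedBall xs R, (1 + ‖w x‖ ^ 3) :=
        integral_mono h2 h13 fun x => by
          nlinarith [mul_nonneg (sq_nonneg (‖w x‖ - 1)) (by positivity : (0 : ℝ) ≤ ‖w x‖ + 1),
            norm_nonneg (w x)]
    _ = (volume : Measure (EuclideanSpace ℝ (Fin 3))).real (closedBall xs R) + ∫ x in closedBall xs R, ‖w x‖ ^ 3 := by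
        rw [integral_add hc h3, setIntegral_const, smul_eq_mul, mul_one]
    _ ≤ _ := add_le_add_right (hardyEnergyBound_ledger_setIntegral_cube_le hw3 _) _

omit hw in
/-- `∫_K |Π||w| ≤ C_{3/2} ∫ |w|³`. -/
theorem hardyEnergyBound_ledger_setIntegral_abs_rieszPressure_mul_le (K : Set (EuclideanSpace ℝ (Fin 3))) :
    ∫ x in K, |rieszPressure w x| * ‖w x‖ ≤ steinConstThreeHalves * ∫ x, ‖w x‖ ^ 3 := by
  obtain ⟨hint, hle⟩ := hardyEnergyBound_ledger_integral_abs_rieszPressure_mul_norm_le hw3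
  exact (setIntegral_le_integral hint (Eventually.of_forall fun x => by positivity)).trans hle

include hx₀ hL₁0 hL₂0 hL₁ hL₂ in
/-- **Bound for the annulus term**: `|∫A| ≤ |ν|(4L₂/R + 32L₁/R²)(|B̄| + ∫|w|³)`. -/
theorem hardyEnergyBound_ledger_abs_integral_ledgerA_le (ν : ℝ) :
    |∫ x, hardyEnergyBound_ledgerA ν (hardyEnergyBound_ledger_cutoff xs hR) w x₀ x| ≤
      |ν| * (L₂ * (4 / R) + 2 * L₁ * (16 / R ^ 2)) *
        ((volume : Measure (EuclideanSpace ℝ (Fin 3))).real (closedBall xs R) + ∫ x, ‖w x‖ ^ 3) := by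
  set a : ℝ := |ν| * (L₂ * (4 / R) + 2 * L₁ * (16 / R ^ 2)) with ha
  have ha0 : 0 ≤ a := by positivity
  have hg : Integrable ((closedBall xs R).indicator fun x => a * ‖w x‖ ^ 2) :=
    (hardyEnergyBound_ledger_integrableOn_norm_pow hw (isCompact_closedBall xs R) a 2).integrable_indicator
      measurableSet_closedBall
  have hb : ∀ x, ‖hardyEnergyBound_ledgerA ν (hardyEnergyBound_ledger_cutoff xs hR) w x₀ x‖ ≤
      (closedBall xs R).indicator (fun x => a * ‖w x‖ ^ 2) x := fun x => by
    rw [Real.norm_eq_abs]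
    by_cases hx : x ∈ closedBall xs R
    · rw [indicator_of_mem hx]
      exact hardyEnergyBound_ledger_abs_ledgerA_le hR hx₀ hL₁0 hL₂0 hL₁ hL₂ ν w x
    · rw [indicator_of_notMem hx, hardyEnergyBound_ledgerA_eq_zero hR ν w hx, abs_zero]
  rw [← Real.norm_eq_abs]
  refine (norm_integral_le_of_norm_le hg (Eventually.of_forall hb)).trans ?_
  rw [integral_indicator measurableSet_closedBall, integral_const_mul]
  exact mul_le_mul_of_nonneg_left (hardyEnergyBound_ledger_setIntegral_sq_le hw hw3) ha0

include hx₀ hL₁0 hL₁ in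
/-- **Bound for the cut-off transport–pressure term**: `|∫B_Π| ≤ (4L₁/R)(1 + 2C_{3/2}) ∫|w|³`. -/
theorem hardyEnergyBound_ledger_abs_integral_ledgerB_le :
    |∫ x, hardyEnergyBound_ledgerB (hardyEnergyBound_ledger_cutoff xs hR) w (rieszPressure w) x₀ x| ≤
      4 * L₁ / R * (1 + 2 * steinConstThreeHalves) * ∫ x, ‖w x‖ ^ 3 := by
  have hK : IsCompact (closedBall xs R) := isCompact_closedBall xs R
  obtain ⟨hPw, -⟩ := hardyEnergyBound_ledger_integral_abs_rieszPressure_mul_norm_le hw3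
  have h3 : IntegrableOn (fun x => 4 * L₁ / R * ‖w x‖ ^ 3) (closedBall xs R) :=
    hardyEnergyBound_ledger_integrableOn_norm_pow hw hK _ 3
  have hP : IntegrableOn (fun x => 8 * L₁ / R * (|rieszPressure w x| * ‖w x‖)) (closedBall xs R) :=
    hPw.integrableOn.const_mul _
  set g : (EuclideanSpace ℝ (Fin 3)) → ℝ := fun x => 4 * L₁ / R * ‖w x‖ ^ 3 + 8 * L₁ / R * (|rieszPressure w x| * ‖w x‖)
    with hg_def
  have hg : Integrable ((closedBall xs R).indicator g) := (h3.add hP).integrable_indicator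
    measurableSet_closedBall
  have hb : ∀ x, ‖hardyEnergyBound_ledgerB (hardyEnergyBound_ledger_cutoff xs hR) w
      (rieszPressure w) x₀ x‖ ≤ (closedBall xs R).indicator g x := fun x => by
    rw [Real.norm_eq_abs]
    by_cases hx : x ∈ closedBall xs R
    · rw [indicator_of_mem hx]
      refine (hardyEnergyBound_ledger_abs_ledgerB_le hR hx₀ hL₁0 hL₁ w _ x).trans_eq ?_
      simp only [hg_def]; ring
    · rw [indicator_of_notMem hx, hardyEnergyBound_ledgerB_eq_zero hR w _ hx, abs_zero]
  rw [← Real.norm_eq_abs]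
  refine (norm_integral_le_of_norm_le hg (Eventually.of_forall hb)).trans ?_
  rw [integral_indicator measurableSet_closedBall, hg_def, integral_add h3 hP, integral_const_mul,
    integral_const_mul]
  rw [show 4 * L₁ / R * (1 + 2 * steinConstThreeHalves) * ∫ x, ‖w x‖ ^ 3 = 4 * L₁ / R *
    (∫ x, ‖w x‖ ^ 3) + 8 * L₁ / R * (steinConstThreeHalves * ∫ x, ‖w x‖ ^ 3) by ring]
  have h4 : 0 ≤ 4 * L₁ / R := by positivity
  have h8 : 0 ≤ 8 * L₁ / R := by positivity
  exact add_le_add (mul_le_mul_of_nonneg_left (hardyEnergyBound_ledger_setIntegral_cube_le hw3 _) h4)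
    (mul_le_mul_of_nonneg_left
      (hardyEnergyBound_ledger_setIntegral_abs_rieszPressure_mul_le hw3 _) h8)

include hx₀ hR in
/-- **Bound for the influx deficit**: `|∫_{B_R}(φ−1)flux_Π| ≤ (16/R²)(1/2 + C_{3/2}) ∫|w|³`. -/
theorem hardyEnergyBound_ledger_abs_integral_deficit_le :
    |∫ x in ball xs R, (hardyEnergyBound_ledger_cutoff xs hR x - 1) *
        hardyEnergyBound_ledgerFlux w (rieszPressure w) x₀ x| ≤
      16 / R ^ 2 * (1 / 2 + steinConstThreeHalves) * ∫ x, ‖w x‖ ^ 3 := by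
  obtain ⟨hPw, -⟩ := hardyEnergyBound_ledger_integral_abs_rieszPressure_mul_norm_le hw3
  have h3 : IntegrableOn (fun x => 16 / R ^ 2 / 2 * ‖w x‖ ^ 3) (ball xs R) :=
    (hardyEnergyBound_ledger_integrableOn_norm_pow hw (isCompact_closedBall xs R) _ 3).mono_set
      ball_subset_closedBall
  have hP : IntegrableOn (fun x => 16 / R ^ 2 * (|rieszPressure w x| * ‖w x‖)) (ball xs R) :=
    hPw.integrableOn.const_mul _
  have hb : ∀ x, ‖(hardyEnergyBound_ledger_cutoff xs hR x - 1) *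
      hardyEnergyBound_ledgerFlux w (rieszPressure w) x₀ x‖ ≤
      16 / R ^ 2 / 2 * ‖w x‖ ^ 3 + 16 / R ^ 2 * (|rieszPressure w x| * ‖w x‖) := fun x => by
    rw [Real.norm_eq_abs]
    refine (hardyEnergyBound_ledger_abs_sub_one_mul_ledgerFlux_le hR hx₀ w _ x).trans_eq ?_
    ring
  have hg : IntegrableOn (fun x => 16 / R ^ 2 / 2 * ‖w x‖ ^ 3 +
      16 / R ^ 2 * (|rieszPressure w x| * ‖w x‖)) (ball xs R) := h3.add hP
  rw [← Real.norm_eq_abs]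
  refine (norm_integral_le_of_norm_le hg (Eventually.of_forall hb)).trans ?_
  rw [integral_add h3 hP, integral_const_mul, integral_const_mul]
  rw [show 16 / R ^ 2 * (1 / 2 + steinConstThreeHalves) * ∫ x, ‖w x‖ ^ 3 = 16 / R ^ 2 / 2 *
    (∫ x, ‖w x‖ ^ 3) + 16 / R ^ 2 * (steinConstThreeHalves * ∫ x, ‖w x‖ ^ 3) by ring]
  have h4 : 0 ≤ 16 / R ^ 2 / 2 := by positivity
  have h8 : 0 ≤ 16 / R ^ 2 := by positivity
  exact add_le_add (mul_le_mul_of_nonneg_left (hardyEnergyBound_ledger_setIntegral_cube_le hw3 _) h4)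
    (mul_le_mul_of_nonneg_left
      (hardyEnergyBound_ledger_setIntegral_abs_rieszPressure_mul_le hw3 _) h8)

/-! ### The pressure swap on one slice -/

include hx₀ hL₁0 hL₂0 hL₁ hL₂ in
/-- **The pressure swap.** If the continuous pressure `q` agrees a.e. with `Π[w] + c` and the
solenoidal flux identity `∫Dφ(w)/r = ∫φ⟨w, x−x₀⟩/r³` holds, then
`∫(A + B_q − C_q) = ∫A + ∫B_Π − 2∫_{B_R}(φ−1)flux_Π − 2∫_{B_R}flux_Π`: the constant `c` drops out and
the weighted influx splits into the deficit and the sharp influx. -/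
theorem hardyEnergyBound_ledger_pressure_swap (ν : ℝ) {q : (EuclideanSpace ℝ (Fin 3)) → ℝ} (hq : Continuous q) {c : ℝ}
    (hqc : ∀ᵐ x ∂(volume : Measure (EuclideanSpace ℝ (Fin 3))), q x = rieszPressure w x + c)
    (hsol : ∫ x, fderiv ℝ (hardyEnergyBound_ledger_cutoff xs hR) x (w x) / ‖x - x₀‖ =
      ∫ x, hardyEnergyBound_ledger_cutoff xs hR x * inner ℝ (w x) (x - x₀) / ‖x - x₀‖ ^ 3) :
    ∫ x, (hardyEnergyBound_ledgerA ν (hardyEnergyBound_ledger_cutoff xs hR) w x₀ x +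
        hardyEnergyBound_ledgerB (hardyEnergyBound_ledger_cutoff xs hR) w q x₀ x -
        hardyEnergyBound_ledgerC (hardyEnergyBound_ledger_cutoff xs hR) w q x₀ x) =
      (∫ x, hardyEnergyBound_ledgerA ν (hardyEnergyBound_ledger_cutoff xs hR) w x₀ x) +
        (∫ x, hardyEnergyBound_ledgerB (hardyEnergyBound_ledger_cutoff xs hR) w (rieszPressure w) x₀ x) -
        2 * (∫ x in ball xs R, (hardyEnergyBound_ledger_cutoff xs hR x - 1) *
          hardyEnergyBound_ledgerFlux w (rieszPressure w) x₀ x) -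
        2 * (∫ x in ball xs R, hardyEnergyBound_ledgerFlux w (rieszPressure w) x₀ x) := by
  set φ := hardyEnergyBound_ledger_cutoff xs hR with hφ
  set P := rieszPressure w with hP
  have hPm : AEStronglyMeasurable P volume := aestronglyMeasurable_rieszPressure hw3
  -- integrability of the pieces
  have hA : Integrable (hardyEnergyBound_ledgerA ν φ w x₀) :=
    hardyEnergyBound_ledger_integrable_ledgerA hR hx₀ hL₁0 hL₂0 hL₁ hL₂ hw ν
  have hBq : Integrable (hardyEnergyBound_ledgerB φ w q x₀) :=
    hardyEnergyBound_ledger_integrable_ledgerB hR hx₀ hL₁0 hL₁ hw hq.aestronglyMeasurable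
      (hardyEnergyBound_ledger_integrableOn_abs_mul_norm hq hw (isCompact_closedBall xs R))
  have hBP : Integrable (hardyEnergyBound_ledgerB φ w P x₀) :=
    hardyEnergyBound_ledger_integrable_ledgerB hR hx₀ hL₁0 hL₁ hw hPm
      (hardyEnergyBound_ledger_integral_abs_rieszPressure_mul_norm_le hw3).1.integrableOn
  have hAB : Integrable fun x => hardyEnergyBound_ledgerA ν φ w x₀ x + hardyEnergyBound_ledgerB φ w q x₀ x :=
    hA.add hBq
  have hCq : Integrable (hardyEnergyBound_ledgerC φ w q x₀) :=
    hardyEnergyBound_ledger_integrable_ledgerC hR hw hq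
  have hD : Integrable fun x => fderiv ℝ φ x (w x) / ‖x - x₀‖ :=
    hardyEnergyBound_ledger_integrable_fderiv_apply_div hR hx₀ hL₁0 hL₁ hw
  have hI : Integrable fun x => φ x * inner ℝ (w x) (x - x₀) / ‖x - x₀‖ ^ 3 :=
    hardyEnergyBound_ledger_integrable_cutoff_mul_inner_div hR hw
  -- the pressure substitution, pointwise a.e.
  have hBae : ∀ᵐ x ∂(volume : Measure (EuclideanSpace ℝ (Fin 3))), hardyEnergyBound_ledgerB φ w q x₀ x =
      hardyEnergyBound_ledgerB φ w P x₀ x + 2 * c * (fderiv ℝ φ x (w x) / ‖x - x₀‖) := by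
    filter_upwards [hqc] with x hx
    simp only [hardyEnergyBound_ledgerB, hx]
    ring
  have hCae : ∀ᵐ x ∂(volume : Measure (EuclideanSpace ℝ (Fin 3))), hardyEnergyBound_ledgerC φ w q x₀ x =
      hardyEnergyBound_ledgerC φ w P x₀ x + 2 * c * (φ x * inner ℝ (w x) (x - x₀) / ‖x - x₀‖ ^ 3) := by
    filter_upwards [hqc] with x hx
    simp only [hardyEnergyBound_ledgerC, hx]
    ring
  have hCP : Integrable (hardyEnergyBound_ledgerC φ w P x₀) := by
    refine (hCq.sub (hI.const_mul (2 * c))).congr ?_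
    filter_upwards [hCae] with x hx
    rw [Pi.sub_apply, hx]
    ring
  -- the three whole-space integrals
  have e1 : ∫ x, (hardyEnergyBound_ledgerA ν φ w x₀ x + hardyEnergyBound_ledgerB φ w q x₀ x -
      hardyEnergyBound_ledgerC φ w q x₀ x) = (∫ x, hardyEnergyBound_ledgerA ν φ w x₀ x) +
      (∫ x, hardyEnergyBound_ledgerB φ w q x₀ x) - ∫ x, hardyEnergyBound_ledgerC φ w q x₀ x := by
    rw [integral_sub hAB hCq, integral_add hA hBq]
  have e2 : ∫ x, hardyEnergyBound_ledgerB φ w q x₀ x = (∫ x, hardyEnergyBound_ledgerB φ w P x₀ x) +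
      2 * c * ∫ x, fderiv ℝ φ x (w x) / ‖x - x₀‖ := by
    rw [integral_congr_ae hBae, integral_add hBP (hD.const_mul _), integral_const_mul]
  have e3 : ∫ x, hardyEnergyBound_ledgerC φ w q x₀ x = (∫ x, hardyEnergyBound_ledgerC φ w P x₀ x) +
      2 * c * ∫ x, φ x * inner ℝ (w x) (x - x₀) / ‖x - x₀‖ ^ 3 := by
    rw [integral_congr_ae hCae, integral_add hCP (hI.const_mul _), integral_const_mul]
  -- the weighted influx: restrict to the ball and split off the deficit
  have hfluxP : IntegrableOn (hardyEnergyBound_ledgerFlux w P x₀) (ball xs R) := by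
    have h1 : IntegrableOn (hardyEnergyBound_ledgerFlux w q x₀) (ball xs R) :=
      hardyEnergyBound_ledger_integrableOn_ledgerFlux hw hq
    have h2 : IntegrableOn (fun x => c * (inner ℝ (w x) (x - x₀) / ‖x - x₀‖ ^ 3)) (ball xs R) :=
      (hardyEnergyBound_ledger_integrableOn_inner_div hw).const_mul c
    refine (h1.sub h2).congr ?_
    filter_upwards [ae_restrict_of_ae (s := ball xs R) hqc] with x hx
    rw [Pi.sub_apply]
    simp only [hardyEnergyBound_ledgerFlux, hx]
    ring
  have hφfluxP : IntegrableOn (fun x => φ x * hardyEnergyBound_ledgerFlux w P x₀ x) (ball xs R) := by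
    have e : (fun x => φ x * hardyEnergyBound_ledgerFlux w P x₀ x) =
        fun x => 1 / 2 * hardyEnergyBound_ledgerC φ w P x₀ x := by
      funext x; rw [hardyEnergyBound_ledgerC_eq]; ring
    rw [e]
    exact (hCP.const_mul _).integrableOn
  have hdef : IntegrableOn (fun x => (φ x - 1) * hardyEnergyBound_ledgerFlux w P x₀ x) (ball xs R) := by
    refine (hφfluxP.sub hfluxP).congr (Eventually.of_forall fun x => ?_)
    rw [Pi.sub_apply]
    ring
  have e4 : ∫ x, hardyEnergyBound_ledgerC φ w P x₀ x =
      2 * ((∫ x in ball xs R, (φ x - 1) * hardyEnergyBound_ledgerFlux w P x₀ x) +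
        ∫ x in ball xs R, hardyEnergyBound_ledgerFlux w P x₀ x) := by
    have h1 : ∫ x, hardyEnergyBound_ledgerC φ w P x₀ x =
        2 * ∫ x, φ x * hardyEnergyBound_ledgerFlux w P x₀ x := by
      rw [← integral_const_mul]
      exact integral_congr_ae (Eventually.of_forall fun x => hardyEnergyBound_ledgerC_eq hR w P x)
    have h2 : ∫ x, φ x * hardyEnergyBound_ledgerFlux w P x₀ x =
        ∫ x in ball xs R, φ x * hardyEnergyBound_ledgerFlux w P x₀ x := by
      refine (setIntegral_eq_integral_of_forall_compl_eq_zero fun x hx => ?_).symm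
      have h0 : φ x = 0 := by
        by_contra h
        exact hx (hardyEnergyBound_ledger_mem_ball_of_cutoff_ne_zero xs hR h)
      rw [h0, zero_mul]
    have h3 : ∫ x in ball xs R, φ x * hardyEnergyBound_ledgerFlux w P x₀ x =
        (∫ x in ball xs R, (φ x - 1) * hardyEnergyBound_ledgerFlux w P x₀ x) +
          ∫ x in ball xs R, hardyEnergyBound_ledgerFlux w P x₀ x := by
      rw [← integral_add hdef hfluxP]
      exact integral_congr_ae (Eventually.of_forall fun x => by ring)
    rw [h1, h2, h3]
  rw [e1, e2, e3, e4, hsol]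
  ring

end Slice

/-- **Anchor of this helper file** (registered sub-goal of `stub_hardyLedger_of`): the cube control
`∫_{B̄} |w|² ≤ |B̄| + ∫ |w|³` of a continuous `L³` field. -/
theorem hardyEnergyBound_ledger_cubeControl :
    ∀ (w : EuclideanSpace ℝ (Fin 3) → EuclideanSpace ℝ (Fin 3)), Continuous w →
      MeasureTheory.MemLp w 3 MeasureTheory.volume → ∀ (c : EuclideanSpace ℝ (Fin 3)) (R : ℝ),
      ∫ x in Metric.closedBall c R, ‖w x‖ ^ 2 ≤
        (MeasureTheory.volume : MeasureTheory.Measure (EuclideanSpace ℝ (Fin 3))).real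
          (Metric.closedBall c R) + ∫ x, ‖w x‖ ^ 3 :=
  fun _ hw hw3 _ _ => hardyEnergyBound_ledger_setIntegral_sq_le hw hw3

end Summit.NavierStokesRegularity.NavierStokesRegularity.Theorems

end
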